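import Mathlib.Analysis.InnerProductSpace.PiL2
import Literature.MathematicalPhysics.QuantumLattice.GrassmannLaplacianGramBound
import Literature.MathematicalPhysics.QuantumFieldTheory.Dimock2011to13.QED3FermionNorm
import HarnessLib

/-!
# Dimock, *Quantum electrodynamics on the 3-torus I*, Appendix B: (309)–(313) and LEMMA 21 —
# `|∫ F dμ_Γ| ≤ ‖F‖_h` whenever `√‖Γ‖₍₂₎ ≤ h` — PROVED (Hadamard's inequality on the fermionic determinants)

statement-level skeleton of published theorems with citation tags; proofs where landed; nothing here is a claim about the Yang–Mills mass gap

**Citation header (reproduction of PUBLISHED work).** J. Dimock, *Quantum electrodynamics on the 3-torus. I. First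
step*, arXiv:math-ph/0210020 (2002) [Dimock2002QED3TorusI], **Appendix B**, p.63 L22 – p.64 L12 of the arXiv-v1 text
layer `paper:arxiv-math-ph_0210020`. Writer seat p11 (literature-prover-lit-balaban-p11-g15-0), YM LIT SWEEP item (c) D12;
companion of `QED3FermionNorm.lean` (the norm `‖F‖_h` (299), LEMMAS 19–20).

**The printed text.** p.63 L22–31: *"A fermion Gaussian "measure" with non-singular covariance `Γ = D⁻¹` can be defined
by `dμ_Γ(Ψ,Ψ̄) = e^{−(Ψ̄,DΨ)}dΨdΨ̄ / ∫ e^{−(Ψ̄,DΨ)}dΨdΨ̄` (308). Then one can consider integrals of the form `∫F dμ_Γ`.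
Terms with `n ≠ m` give zero while terms with `n = m` are integrated by
`∫ Ψ(x₁)Ψ̄(x̄₁)⋯Ψ(x_n)Ψ̄(x̄_n) dμ_Γ(Ψ,Ψ̄) = det{Γ(x_i,x̄_j)}` (309) … This identity can also be used to define `dμ_Γ`
when `Γ` is singular. To estimate these integrals we introduce `‖Γ‖₍₂₎ = (sup_x Σ_{x̄} |Γ(x,x̄)|²)^{1/2}` (310)."*
**LEMMA 21** (p.64 L1–3): *"If `√‖Γ‖₍₂₎ ≤ h` then `|∫ F(Ψ,Ψ̄) dμ_Γ(Ψ,Ψ̄)| ≤ ‖F‖_h` (311)."* Proof (p.64 L4–12): the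
integral is `Σ_n (σ_n/(n!)²) Σ f_{n,n}(x,x̄) det{Γ(x_i,x̄_j)}` (312); *"By Hadamard's inequality [18] we have
`|det{Γ(x_i,x̄_j)}| ≤ (‖Γ‖₍₂₎)^n ≤ h^{2n}` (313) and so the result: `|∫F dμ_Γ| ≤ Σ_n (h^{2n}/(n!)²)‖f_{n,n}‖₁ ≤ ‖F‖_h` (314)."*

**What is here.** The Gaussian integral `∫·dμ_Γ` is the tree's `QuantumLattice.gaussExpect 𝕜 C` (Salmhofer's
`μ_C ⋆` calculus on `GrassmannAlgebra 𝕜 ι`) for a CHARGED covariance `C` — a charge map `q : ι → Bool` splits the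
generators into `Ψ̄` (`q = true`) and `Ψ` (`q = false`), and `C` pairs only opposite charges — whose two-point function
`Γ(x,x̄) = ∫Ψ(x)Ψ̄(x̄)` is the tree's `contr 𝕜 C x x̄`; (309) is then the tree's THEOREM `gaussExpect_genProd_mul_genProd`
(block determinant rule) together with the `U(1)` selection rule `gaussExpect_genProd_eq_zero_of_charge` (*"terms with
`n ≠ m` give zero"*), exactly the defining property the paper allows for singular `Γ`. Then:
* `norm_det_le_prod_sqrt_col` — Hadamard's inequality `|det M| ≤ Π_j (Σ_i|M_ij|²)^{1/2}` over `𝕜 = ℝ, ℂ` (from the tree's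
  `InnerProduct.GramHadamard.norm_det_le_prod_norm` in the standard orthonormal basis);
* `twoNormSq`, `twoNorm` — (310);
* `norm_gaussExpect_genProd_le_pow` — (312)–(313) for ONE monomial with distinct labels: `|∫Ψ(ξ₁)⋯Ψ(ξ_N)dμ_Γ| ≤ h^N`
  when every row sum `Σ_{x̄}|Γ(x,x̄)|² ≤ h⁴` (sort into block form at the cost of a sign, determinant rule, Hadamard by
  columns — column `j` of `{Γ(x̄_i,x_j)}` has `Σ_i|Γ(x_j,x̄_i)|² ≤ Σ_{x̄}|Γ(x_j,x̄)|²` because the `x̄_i` are distinct);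
* **`norm_gaussExpect_le_hNorm` — LEMMA 21** as printed: `√‖Γ‖₍₂₎ ≤ h ⟹ ‖∫F dμ_Γ‖ ≤ ‖F‖_h`, by expanding `F` in the
  monomial basis (`‖F‖_h = Σ_S h^{#S}|c_S|`, file `QED3FermionNorm.lean`) — this is (314).
The structure of the monomial bound follows the tree's Gram-form sibling `norm_gaussExpect_genProd_le`
(`GrassmannLaplacianGramBound.lean`), with the Gram hypothesis replaced by the printed row-`ℓ²` hypothesis (310).
Not here: (315)–(319), LEMMA 22 (partial integration with spectator fields), LEMMAS 23–25. No named facts, no `sorry`.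
-/

noncomputable section

open Finset

namespace Literature.MathematicalPhysics.QuantumFieldTheory.Dimock2011to13

namespace QED3TorusI

open Literature.MathematicalPhysics.QuantumLattice
open Literature.MathematicalPhysics.QuantumLattice.GrassmannAlgebra

variable {𝕜 : Type*} [RCLike 𝕜] {ι : Type*} [LinearOrder ι] [Fintype ι]

/-! ## Hadamard's inequality, column form, over `𝕜` -/

omit [LinearOrder ι] [Fintype ι] in
/-- **Hadamard's inequality** (313): `|det M| ≤ ∏_j (Σ_i |M_ij|²)^{1/2}` (columns), for `𝕜 = ℝ, ℂ`.
[cite: Dimock2002QED3TorusI, App. B (313) p.64 L8–10 («By Hadamard's inequality [18]»)] -/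
theorem norm_det_le_prod_sqrt_col {n : ℕ} (M : Matrix (Fin n) (Fin n) 𝕜) :
    ‖M.det‖ ≤ ∏ k, Real.sqrt (∑ j, ‖M j k‖ ^ 2) := by
  classical
  let f : Fin n → EuclideanSpace 𝕜 (Fin n) := fun k => WithLp.toLp 2 fun j => M j k
  have hf : ∀ k, ‖f k‖ = Real.sqrt (∑ j, ‖M j k‖ ^ 2) := fun k => by
    rw [EuclideanSpace.norm_eq]
  set e := EuclideanSpace.basisFun (Fin n) 𝕜 with he
  have hdet : M.det = e.toBasis.det f := by
    rw [Module.Basis.det_apply]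
    rfl
  rw [hdet]
  refine (Literature.Analysis.InnerProduct.norm_det_le_prod_norm e f).trans (le_of_eq ?_)
  exact Finset.prod_congr rfl fun k _ => hf k

/-! ## (310) and the monomial bound (312)–(313) -/

/-- **(310)** `‖Γ‖²₍₂₎ = sup_x Σ_{x̄} |Γ(x,x̄)|²` for the two-point function `Γ(x,x̄) = ∫Ψ(x)Ψ̄(x̄)dμ_Γ` of a charged
covariance (`x` ranges over the unbarred labels `q = false`; `A = contr C` is the tree's two-point function).
[cite: Dimock2002QED3TorusI, App. B (310) p.63 L33–36] -/
def twoNormSq (q : ι → Bool) (A : Matrix ι ι 𝕜) : ℝ := ⨆ x : {x // q x = false}, ∑ y, ‖A x y‖ ^ 2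

/-- **(310)** `‖Γ‖₍₂₎ = (sup_x Σ_{x̄} |Γ(x,x̄)|²)^{1/2}`. [cite: Dimock2002QED3TorusI, App. B (310) p.63 L33–36] -/
def twoNorm (q : ι → Bool) (A : Matrix ι ι 𝕜) : ℝ := Real.sqrt (twoNormSq q A)

omit [LinearOrder ι] [Fintype ι] in
/-- Each row sum `Σ_{x̄}|Γ(x,x̄)|²` is below `‖Γ‖²₍₂₎`. [cite: Dimock2002QED3TorusI, App. B (310) p.63 L33–36] -/
theorem sum_sq_le_twoNormSq [Fintype ι] (q : ι → Bool) (A : Matrix ι ι 𝕜) {x : ι} (hx : q x = false) :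
    ∑ y, ‖A x y‖ ^ 2 ≤ twoNormSq q A :=
  le_ciSup (f := fun x : {x // q x = false} => ∑ y, ‖A (x : ι) y‖ ^ 2) (Set.finite_range _).bddAbove ⟨x, hx⟩

omit [LinearOrder ι] [Fintype ι] in
/-- `‖Γ‖²₍₂₎ ≥ 0`. [cite: Dimock2002QED3TorusI, App. B (310) p.63 L33–36] -/
theorem twoNormSq_nonneg [Fintype ι] (q : ι → Bool) (A : Matrix ι ι 𝕜) : 0 ≤ twoNormSq q A := by
  rcases isEmpty_or_nonempty {x // q x = false} with h | h
  · simp [twoNormSq]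
  · exact le_ciSup_of_le (Set.finite_range _).bddAbove (Classical.arbitrary _)
      (Finset.sum_nonneg fun _ _ => sq_nonneg _)

/-- **(312)–(313) for one monomial**: for a charged covariance with `‖Γ‖₍₂₎ ≤ h²` (i.e. `√‖Γ‖₍₂₎ ≤ h`), a monomial
`Ψ(ξ₁)⋯Ψ(ξ_N)` with DISTINCT labels integrates to at most `h^N` in modulus: it is `± det{Γ(x_i,x̄_j)}` when balanced
(`N = 2n`, the tree's block determinant rule), `|det| ≤ ‖Γ‖₍₂₎^n ≤ h^{2n}` by Hadamard, and `0` when unbalanced.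
[cite: Dimock2002QED3TorusI, App. B (312)–(313) p.64 L3–10] -/
theorem norm_gaussExpect_genProd_le_pow (q : ι → Bool) (C : Matrix ι ι 𝕜) (hC : ∀ X Y, q X = q Y → C X Y = 0)
    {h : ℝ} (hh : 0 ≤ h) (hΓ : ∀ x, q x = false → ∑ y, ‖contr 𝕜 C x y‖ ^ 2 ≤ h ^ 4)
    {N : ℕ} (Z : Fin N → ι) (hZinj : Function.Injective Z) : ‖gaussExpect 𝕜 C (genProd 𝕜 Z)‖ ≤ h ^ N := by
  set p : Fin N → Prop := fun i => q (Z i) = true with hp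
  set a := (univ.filter fun i => p i).card with ha
  set b := (univ.filter fun i => ¬ p i).card with hb
  have hN : a + b = N := by rw [ha, hb, card_filter_add_card_filter_not, card_univ, Fintype.card_fin]
  by_cases hab : b = a
  · have hca : Fintype.card {i // p i} = a := by rw [Fintype.card_subtype]
    have hcb : Fintype.card {i // ¬ p i} = a := by rw [Fintype.card_subtype, ← hab]
    set e₁ : {i // p i} ≃ Fin a := Fintype.equivFinOfCardEq hca with he₁
    set e₂ : {i // ¬ p i} ≃ Fin a := Fintype.equivFinOfCardEq hcb with he₂
    set Xb : Fin a → ι := fun i => Z (e₁.symm i) with hXb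
    set Xu : Fin a → ι := fun j => Z (e₂.symm j) with hXu
    set σ : Fin N ≃ Fin a ⊕ Fin a := (Equiv.sumCompl p).symm.trans (e₁.sumCongr e₂) with hσ
    have haa : a + a = N := by rw [← hN, hab]
    set ρ : Equiv.Perm (Fin N) := (σ.trans finSumFinEquiv).trans (finCongr haa) with hρ
    have hZ : Z = (Fin.append Xb Xu ∘ (finCongr haa).symm) ∘ ρ := by
      have hsymm : ∀ x : Fin a ⊕ Fin a, Z (σ.symm x) = Fin.append Xb Xu (finSumFinEquiv x) := by
        rintro (i | j)
        · rw [finSumFinEquiv_apply_left, Fin.append_left, hσ, Equiv.symm_trans_apply, Equiv.symm_symm,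
            Equiv.sumCongr_symm, Equiv.sumCongr_apply, Sum.map_inl, Equiv.sumCompl_apply_inl]
        · rw [finSumFinEquiv_apply_right, Fin.append_right, hσ, Equiv.symm_trans_apply, Equiv.symm_symm,
            Equiv.sumCongr_symm, Equiv.sumCongr_apply, Sum.map_inr, Equiv.sumCompl_apply_inr]
      funext i
      have h := hsymm (σ i)
      rw [Equiv.symm_apply_apply] at h
      rw [h, hρ]
      simp only [Function.comp_apply, Equiv.trans_apply, Equiv.symm_apply_apply]
    have hbb : ∀ i j, contr 𝕜 C (Xb i) (Xb j) = 0 := by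
      intro i j
      have hi : q (Xb i) = true := (e₁.symm i).2
      have hj : q (Xb j) = true := (e₁.symm j).2
      rw [contr_apply, hC _ _ (hj.trans hi.symm), hC _ _ (hi.trans hj.symm), sub_self, mul_zero]
    have hXb_inj : Function.Injective Xb := fun i j hij => by
      have := hZinj hij
      exact e₁.symm.injective (Subtype.ext this)
    have hdet := gaussExpect_genProd_mul_genProd 𝕜 C Xb Xu hbb
    rw [hZ, genProd_comp_perm, map_smul, finCongr_symm, genProd_comp_finCongr, genProd_append, hdet, smul_eq_mul,
      norm_intCast_units_smul, norm_mul, norm_pow, norm_neg, norm_one, one_pow, one_mul]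
    refine (norm_det_le_prod_sqrt_col _).trans ?_
    -- each column `j` of `{Γ(x̄_i, x_j)}`: `Σ_i |Γ(x_j, x̄_i)|² ≤ Σ_{x̄} |Γ(x_j, x̄)|² ≤ h⁴` (distinct `x̄_i`)
    have hcol : ∀ j, Real.sqrt (∑ i, ‖(Matrix.of fun i j => contr 𝕜 C (Xb i) (Xu j)) i j‖ ^ 2) ≤ h ^ 2 := by
      intro j
      rw [show h ^ 2 = Real.sqrt ((h ^ 2) ^ 2) by rw [Real.sqrt_sq (pow_nonneg hh 2)]]
      refine Real.sqrt_le_sqrt ?_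
      have hq : q (Xu j) = false := Bool.eq_false_iff.2 (e₂.symm j).2
      calc ∑ i, ‖(Matrix.of fun i j => contr 𝕜 C (Xb i) (Xu j)) i j‖ ^ 2
          = ∑ i, ‖contr 𝕜 C (Xu j) (Xb i)‖ ^ 2 := by
            refine Finset.sum_congr rfl fun i _ => ?_
            rw [Matrix.of_apply, contr_swap, norm_neg]
        _ = ∑ y ∈ univ.image Xb, ‖contr 𝕜 C (Xu j) y‖ ^ 2 := by
            rw [Finset.sum_image fun i _ j _ hij => hXb_inj hij]
        _ ≤ ∑ y, ‖contr 𝕜 C (Xu j) y‖ ^ 2 :=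
            Finset.sum_le_sum_of_subset_of_nonneg (Finset.subset_univ _) fun _ _ _ => sq_nonneg _
        _ ≤ h ^ 4 := hΓ _ hq
        _ = (h ^ 2) ^ 2 := by ring
    calc ∏ k, Real.sqrt (∑ j, ‖(Matrix.of fun i j => contr 𝕜 C (Xb i) (Xu j)) j k‖ ^ 2)
        ≤ ∏ _k : Fin a, h ^ 2 := Finset.prod_le_prod (fun _ _ => Real.sqrt_nonneg _) fun k _ => hcol k
      _ = h ^ N := by rw [prod_const, card_univ, Fintype.card_fin, ← pow_mul, ← haa]; ring_nf
  · rw [gaussExpect_genProd_eq_zero_of_charge 𝕜 q C hC Z (Ne.symm hab), norm_zero]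
    exact pow_nonneg hh N

/-- The monomial basis vector is the ordered product of its generators, in the tree's `genProd` form (the tree's
`grassmannBasis_eq_genProd'` of `GrassmannKernelExpansion.lean`, re-proved here to keep the imports light):
`θ_S = Ψ(ξ₁)⋯Ψ(ξ_r)` for the increasing enumeration `ξ` of `S`. [cite: Dimock2002QED3TorusI, App. B (298) p.62 L4–8] -/
theorem grassmannBasis_eq_genProd_orderEmb (S : Finset ι) :
    grassmannBasis 𝕜 ι S = genProd 𝕜 (fun i : Fin S.card => S.orderEmbOfFin rfl i) := by
  rw [grassmannBasis_eq_prod_map_gen, genProd, List.ofFn_eq_map, ← Finset.listMap_orderEmbOfFin_finRange S rfl,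
    List.map_map]
  congr 2

/-- (312)–(313) for a basis monomial `θ_S`: `|∫ θ_S dμ_Γ| ≤ h^{#S}` when every row sum `Σ_{x̄}|Γ(x,x̄)|² ≤ h⁴` (`h ≥ 0`).
[cite: Dimock2002QED3TorusI, App. B (312)–(313) p.64 L3–10] -/
theorem norm_gaussExpect_grassmannBasis_le_pow (q : ι → Bool) (C : Matrix ι ι 𝕜)
    (hC : ∀ X Y, q X = q Y → C X Y = 0) {h : ℝ} (hh : 0 ≤ h)
    (hΓ : ∀ x, q x = false → ∑ y, ‖contr 𝕜 C x y‖ ^ 2 ≤ h ^ 4) (S : Finset ι) :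
    ‖gaussExpect 𝕜 C (grassmannBasis 𝕜 ι S)‖ ≤ h ^ S.card := by
  rw [grassmannBasis_eq_genProd_orderEmb]
  exact norm_gaussExpect_genProd_le_pow q C hC hh hΓ _ (S.orderEmbOfFin rfl).injective

omit [LinearOrder ι] in
/-- `√‖Γ‖₍₂₎ ≤ h` unfolds to: `h ≥ 0` and every row sum `Σ_{x̄}|Γ(x,x̄)|² ≤ h⁴`.
[cite: Dimock2002QED3TorusI, App. B (310)–(311) p.63 L33 – p.64 L3] -/
theorem rowBound_of_sqrt_twoNorm_le (q : ι → Bool) (A : Matrix ι ι 𝕜) {h : ℝ} (hΓ : Real.sqrt (twoNorm q A) ≤ h) :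
    0 ≤ h ∧ ∀ x, q x = false → ∑ y, ‖A x y‖ ^ 2 ≤ h ^ 4 := by
  have h2 : twoNormSq q A ≤ (h ^ 2) ^ 2 := (Real.sqrt_le_iff.1 (Real.sqrt_le_iff.1 hΓ).2).2
  exact ⟨(Real.sqrt_le_iff.1 hΓ).1, fun x hx => (sum_sq_le_twoNormSq q A hx).trans (h2.trans_eq (by ring))⟩

/-- **LEMMA 21.** *"If `√‖Γ‖₍₂₎ ≤ h` then `|∫F(Ψ,Ψ̄)dμ_Γ(Ψ,Ψ̄)| ≤ ‖F‖_h`"* (311), for the Gaussian Grassmann integral of a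
charged covariance (the tree's `gaussExpect`, whose moments are the determinants (309) by `gaussExpect_genProd_mul_genProd`).
[cite: Dimock2002QED3TorusI, App. B Lemma 21 (311) p.64 L1–12] -/
theorem norm_gaussExpect_le_hNorm (q : ι → Bool) (C : Matrix ι ι 𝕜) (hC : ∀ X Y, q X = q Y → C X Y = 0)
    {h : ℝ} (hΓ : Real.sqrt (twoNorm q (contr 𝕜 C)) ≤ h) (F : GrassmannAlgebra 𝕜 ι) :
    ‖gaussExpect 𝕜 C F‖ ≤ hNorm h F := by
  obtain ⟨hh, hrow⟩ := rowBound_of_sqrt_twoNorm_le q (contr 𝕜 C) hΓ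
  have hF : F = ∑ S, coeff F S • grassmannBasis 𝕜 ι S := ((grassmannBasis 𝕜 ι).sum_repr F).symm
  conv_lhs => rw [hF]
  rw [map_sum]
  refine (norm_sum_le _ _).trans ?_
  rw [hNorm]
  refine Finset.sum_le_sum fun S _ => ?_
  rw [map_smul, smul_eq_mul, norm_mul, mul_comm]
  exact mul_le_mul_of_nonneg_right (norm_gaussExpect_grassmannBasis_le_pow q C hC hh hrow S) (norm_nonneg _)

end QED3TorusI

end Literature.MathematicalPhysics.QuantumFieldTheory.Dimock2011to13
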